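import Summits.Ventures.HSemireg.FormulaNUniform

/-!
# Venture HSemireg — FORMULA-N, the UNIFORM-IN-n STATEMENT: the PER-`q` LAW of column C13 in every degree,
# `[t^m u^q] Q_n(t,u)²` with `Q_n(t,u) = (1+t)ⁿ + (u+t)ⁿ − tⁿ` (th-6, FORMULA-N PART A §4.1″), as closed-form arithmetic in `n`

HONEST FRAMING. Part of the Lean index of the computation cell `pub-hsemireg` (seat p10, Sunday typer «UNIFORM-IN-n»; this file
p10 gen 2).  ARITHMETIC ONLY: no variety, no cohomology theory, no sheaf, no semiregularity map is constructed here; nothing here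
says that HC / HC_CM / HC_AV holds; no Literature fact is declared or used.  `FormulaNUniform.lean` (1/3) typed column C13 of
STRUCTURE.md v1.0-SIGNED `9b196a05977dd067` §1.1 — the per-`q` BLOCK RANKS of `σ` on `Ext²(G_n, G_n)` into the Dolbeault blocks
`H^{q+2}(Ω^q)`, `(2n² − n, n² − n, 2n², n² − n, 2n² − n)` at `q = (0, n−2, n−1, n, 2n−2)` — as NUMBERS ONLY (`sigmaBlockRank`, an
if-chain, with the signed rows `n = 2..5` by `decide`).  This file types th-6's IDENTIFICATION of that column (theory/FORMULA-N.md
PART A v1.8.x §4.1″ «PER-q LAW IN EVERY DEGREE — IDENTIFIED»; STRUCTURE C13 «IDENTIFIED v0.16 by th-6: refine the point atom by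
the Dolbeault index u, `Q_n(t,u) := (1+t)ⁿ + (u+t)ⁿ − tⁿ`; THEOREM (per-q Künneth) `Σ_{m ≥ 1, q} rank(σ_q ∣ Ext^m(G_n,G_n)) t^m u^q
= Q_n(t,u)²`»; 17/17 measured vectors `n = 2..8`, degrees 1–3) as arithmetic uniform in `n`, and proves what is arithmetic:

* §1 `Q n ∈ ℤ[u][t]` and its coefficients: `[tⁱ u^q] Q_n = qAtom n i q := C(n,i)·([q = 0] + [i < n ∧ q = n − i])` (`coeff_Q`) — the
  u-REFINED POINT ATOM (th-6: the atom of `I_p` in degree `i` has a GLOBAL component, `θ ∈ ∧ⁱV̄*` hitting `1`, target `H^{0,i}`,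
  `q = 0`, rank `C(n,i)`, and a LOCAL component, `θ ∈ ∧ⁱV` hitting `pt`, target `Hⁿ(Ω^{n−i})`, `q = n − i`, rank `C(n,i)`, the two
  coinciding at `i = n`); `Q_n(t,1) = 1 + P_n(t)` (`map_evalOne_Q`: the u-refinement forgets to th-6/th-7's `P_n` of file 1/3, plus
  the degree-0 unit counted twice).
* §2 `blockCount n m q := Σ_{i+j=m} Σ_{q₁+q₂=q} qAtom n i q₁ · qAtom n j q₂` — the double Künneth / Cauchy product — and
  `coeff_Q_sq : [t^m u^q] Q_n(t,u)² = blockCount n m q` for ALL `n, m, q`.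
* §3 THE SIGNED COLUMN IS THE GENERATING FUNCTION: `blockCount n 2 q = sigmaBlockRank n q` for every `n ≥ 3` and every `q`
  (`blockCount_two_eq_sigmaBlockRank`) — i.e. STRUCTURE C13's closed form `(2n²−n, n²−n, 2n², n²−n, 2n²−n, 0 elsewhere)` IS
  `[t² u^q] Q_n(t,u)²`, ONE formula, no fitted entry; the rows `n = 1, 2` agree too (`blockCount_two_small`, by `decide`; at `n = 2`
  the top collapse `i = n = 2` is what makes `(6, 8, 6)` rather than `(8, 8, 8)`); `blockCount_symm`: the vectors are palindromic,
  `[t^k u^q] = [t^k u^{2n−k−q}]` (Serre-type symmetry; global ↔ local).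
* §4 OVERLAP COUNT (red-5's reader caution of record, STRUCTURE C13 v0.27: «Σ_q block ranks (60 at n = 3) ≠ rank σ (48) — the
  blocks overlap»), in closed form: `(Q_n²)(t,1) = (1 + P_n)²`, so `Σ_q [t^m u^q]Q_n² = R_m(n) + 2·r_m(n) + [m = 0]`
  (`sum_blockCount`): the excess of the block sum over the box rank `R_m(n) = boxRank n m` of file 1/3 is exactly `2 r_m(n)`
  (`60 = 48 + 12` at `n = 3`, `m = 2`; `224 = 208 + 16` at `n = 4`, `m = 3`).
* §5 the other printed closed forms, all `n`: degree 1 `2n` at `q ∈ {0, n−1, n, 2n−1}` (`blockCount_one`, `n ≥ 2`) and degree 3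
  `(C(2n,3), 2C(n,3), n²(n−1), n²(n−1), 2C(n,3), C(2n,3))` at `q = (0, n−3, n−2, n−1, n, 2n−3)` (`blockCount_three`, `n ≥ 4`); and the
  vectors of record as kernel `decide`s: degree 1 / 2 rows `n = 2..5`; degree 3 `(20,18,18,20)`, `(56,8,48,48,8,56)`,
  `(120,0,20,100,100,20,0,120)`; middle degree `(70,32,72,32,70)` at `n = m = 4` (FORMULA-N §4.1″ «17/17 exact», «MIDDLE DEGREES
  21/21»).
WHAT IS NOT HERE: that `blockCount n m q` IS the rank of the `q`-block of `σ` on `Ext^m` — on paper th-6's per-q Künneth theorem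
(PART A §2.3 bigrading) with the bridge `σ ∘ ev = ⌟ch` ([BF08] Thm 6.4.2) and the measured tables; in the tree the companion files
`WedgeBoxPerQ*.lean` (p10 gen 2) prove the CLASS-SIDE statement in th-7's wedge model: the rank of the `q`-block projection of
`θ ↦ θ ∧ (f₁ ∧ f₂)` on `⋀^m K^{4n}` is `blockCount n m q` for every `n ≥ 1`, `m ≥ 1`.  Block ranks are NOT additive in `q` (§4) and
NOT Fourier–Mukai / twist invariants (STRUCTURE D5): quoted, not asserted.
-/

open Polynomial Finset

namespace Summit.Ventures.HSemireg.FormulaN.Uniform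

/-! ## §1. The u-refined point atom `Q_n(t,u)` and its coefficients -/

/-- `[tⁱ u^q] Q_n(t,u)`: the u-REFINED POINT ATOM — `C(n,i)` at `q = 0` (global component) plus `C(n,i)` at `q = n − i` for
`i < n` (local component); at `i = n` the two coincide and count once (FORMULA-N PART A §4.1″). -/
def qAtom (n i q : ℕ) : ℕ :=
  (if q = 0 then n.choose i else 0) + (if i < n ∧ q = n - i then n.choose i else 0)

/-- `Q_n(t,u) := (1+t)ⁿ + (u+t)ⁿ − tⁿ` as a polynomial in `t` (outer variable `X`) over `ℤ[u]` (inner variable `C X`)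
(th-6, FORMULA-N PART A §4.1″; STRUCTURE C13 «IDENTIFIED v0.16»). -/
noncomputable def Q (n : ℕ) : ℤ[X][X] := (1 + X) ^ n + (C X + X) ^ n - X ^ n

/-- the `t`-coefficients of `Q_n`: `[tⁱ] Q_n = C(n,i) + C(n,i)·u^{n−i} − [i = n]` in `ℤ[u]`. -/
theorem coeff_Q_outer (n i : ℕ) :
    (Q n).coeff i = (n.choose i : ℤ[X]) + X ^ (n - i) * (n.choose i : ℤ[X]) - if i = n then 1 else 0 := by
  rw [Q, coeff_sub, coeff_add, add_comm (1 : ℤ[X][X]) X, coeff_X_add_one_pow, add_comm (C X) X, coeff_X_add_C_pow,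
    coeff_X_pow]

/-- **`[tⁱ u^q] Q_n(t,u) = qAtom n i q`** for all `n, i, q`. -/
theorem coeff_Q (n i q : ℕ) : ((Q n).coeff i).coeff q = (qAtom n i q : ℤ) := by
  rw [coeff_Q_outer, coeff_sub, coeff_add, coeff_natCast_ite, coeff_X_pow_mul', coeff_natCast_ite, qAtom]
  rcases Nat.lt_trichotomy i n with h | rfl | h
  · rw [if_neg h.ne, coeff_zero, sub_zero]
    push_cast
    split_ifs <;> omega
  · rw [if_pos rfl, coeff_one, Nat.choose_self, Nat.sub_self]
    push_cast
    split_ifs <;> omega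
  · rw [if_neg h.ne', coeff_zero, sub_zero, Nat.choose_eq_zero_of_lt h]
    push_cast
    split_ifs <;> simp

/-- `Q_n(t,1) = 1 + P_n(t)`: forgetting the Dolbeault index `u` (coefficientwise evaluation at `u = 1`) gives th-6/th-7's factor
polynomial `P_n = 2(1+t)ⁿ − 1 − tⁿ` of `FormulaNUniform.lean`, plus the degree-0 unit (the vector `1 − pt` has two `q`-components,
FORMULA-N §4.1″ «Q_n(t,1) = 2(1+t)ⁿ − tⁿ counts T⁰'s two components separately»). -/
theorem map_evalOne_Q (n : ℕ) : (Q n).map (evalRingHom 1) = 1 + P n := by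
  rw [Q, P, Polynomial.map_sub, Polynomial.map_add, Polynomial.map_pow, Polynomial.map_pow, Polynomial.map_pow,
    Polynomial.map_add, Polynomial.map_add, Polynomial.map_one, map_X, map_C, coe_evalRingHom, eval_X, C_1]
  ring

/-! ## §2. The double Künneth product `blockCount` and `[t^m u^q] Q_n²` -/

/-- `blockCount n m q := Σ_{i+j=m} Σ_{q₁+q₂=q} qAtom n i q₁ · qAtom n j q₂` — the per-`q` block count of the box of two u-refined
point atoms in degree `m` (th-6's per-q Künneth: distinct `(i, j, q₁, q₂)` land in distinct Künneth pieces
`H^{q₁+i}(Ω^{q₁}) ⊗ H^{q₂+j}(Ω^{q₂})`, `q = q₁ + q₂`). -/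
def blockCount (n m q : ℕ) : ℕ :=
  ∑ ij ∈ antidiagonal m, ∑ pq ∈ antidiagonal q, qAtom n ij.1 pq.1 * qAtom n ij.2 pq.2

/-- **`[t^m u^q] Q_n(t,u)² = blockCount n m q`** for all `n, m, q` (STRUCTURE C13 / FORMULA-N §4.1″, every degree). -/
theorem coeff_Q_sq (n m q : ℕ) : ((Q n ^ 2).coeff m).coeff q = (blockCount n m q : ℤ) := by
  rw [sq, coeff_mul, finsetSum_coeff, blockCount]
  push_cast
  refine Finset.sum_congr rfl fun ij _ => ?_
  rw [coeff_mul]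
  refine Finset.sum_congr rfl fun pq _ => ?_
  rw [coeff_Q, coeff_Q]

/-! ## §3. Degree 2: the signed column C13 is `[t² u^q] Q_n²` -/

/-- one summand of the inner Cauchy sum: `Σ_{q₁+q₂=q} [q₁ = a]·x · [q₂ = b]·y = [q = a + b]·x·y`. -/
theorem sum_antidiagonal_ite_mul_ite (a b q x y : ℕ) :
    ∑ pq ∈ antidiagonal q, (if pq.1 = a then x else 0) * (if pq.2 = b then y else 0) =
      if q = a + b then x * y else 0 := by
  have h : ∀ pq ∈ antidiagonal q, (if pq.1 = a then x else 0) * (if pq.2 = b then y else 0) =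
      if pq = (a, b) then x * y else 0 := by
    intro pq _
    by_cases h12 : pq = (a, b)
    · subst h12; simp
    · rw [if_neg h12]
      by_cases h1 : pq.1 = a
      · have h2 : pq.2 ≠ b := fun h2 => h12 (Prod.ext h1 h2)
        rw [if_neg h2, mul_zero]
      · rw [if_neg h1, zero_mul]
  rw [Finset.sum_congr rfl h, Finset.sum_ite_eq']
  by_cases hq : q = a + b
  · rw [if_pos (Finset.HasAntidiagonal.mem_antidiagonal.mpr hq.symm), if_pos hq]
  · rw [if_neg (fun hm => hq (Finset.HasAntidiagonal.mem_antidiagonal.mp hm).symm), if_neg hq]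

/-- the inner Cauchy sum of two atoms, in closed form: `Σ_{q₁+q₂=q} qAtom n i q₁ · qAtom n j q₂ =
C(n,i)C(n,j)·([q=0] + [j<n][q=n−j] + [i<n][q=n−i] + [i<n][j<n][q=2n−i−j])`. -/
theorem sum_antidiagonal_qAtom (n i j q : ℕ) :
    ∑ pq ∈ antidiagonal q, qAtom n i pq.1 * qAtom n j pq.2 =
      (if q = 0 then n.choose i * n.choose j else 0) +
      (if j < n ∧ q = n - j then n.choose i * n.choose j else 0) +
      (if i < n ∧ q = n - i then n.choose i * n.choose j else 0) +
      (if i < n ∧ j < n ∧ q = (n - i) + (n - j) then n.choose i * n.choose j else 0) := by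
  have e : ∀ pq : ℕ × ℕ, qAtom n i pq.1 * qAtom n j pq.2 =
      (if pq.1 = 0 then n.choose i else 0) * (if pq.2 = 0 then n.choose j else 0) +
      (if pq.1 = 0 then n.choose i else 0) * (if pq.2 = n - j then (if j < n then n.choose j else 0) else 0) +
      (if pq.1 = n - i then (if i < n then n.choose i else 0) else 0) * (if pq.2 = 0 then n.choose j else 0) +
      (if pq.1 = n - i then (if i < n then n.choose i else 0) else 0) *
        (if pq.2 = n - j then (if j < n then n.choose j else 0) else 0) := by
    intro pq
    have h1 : (if i < n ∧ pq.1 = n - i then n.choose i else 0) =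
        if pq.1 = n - i then (if i < n then n.choose i else 0) else 0 := by
      split_ifs <;> simp_all
    have h2 : (if j < n ∧ pq.2 = n - j then n.choose j else 0) =
        if pq.2 = n - j then (if j < n then n.choose j else 0) else 0 := by
      split_ifs <;> simp_all
    rw [qAtom, qAtom, h1, h2]
    ring
  simp only [e, Finset.sum_add_distrib, sum_antidiagonal_ite_mul_ite, zero_add]
  by_cases hi : i < n <;> by_cases hj : j < n <;> simp [hi, hj]

/-- `C(2n,2) = 2·C(n,2) + n²` (Vandermonde in degree 2: the `q = 0` block `∧²(V̄* ⊕ V̄′*)` of C1's Hodge bookkeeping). -/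
theorem choose_two_add (n : ℕ) : (n + n).choose 2 = 2 * n.choose 2 + n * n := by
  have key : (((n + n).choose 2 : ℕ) : ℚ) = ((2 * n.choose 2 + n * n : ℕ) : ℚ) := by
    push_cast
    rw [Nat.cast_choose_two, Nat.cast_choose_two]
    push_cast
    ring
  exact_mod_cast key

/-- `2·C(n,2) = n² − n`. -/
theorem two_mul_choose_two (n : ℕ) : 2 * n.choose 2 = n ^ 2 - n := by
  have h1 : n ≤ n ^ 2 := by nlinarith
  have key : ((2 * n.choose 2 : ℕ) : ℚ) = ((n ^ 2 - n : ℕ) : ℚ) := by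
    push_cast [Nat.cast_sub h1]
    rw [Nat.cast_choose_two]
    ring
  exact_mod_cast key

/-- `C(2n,2) = 2n² − n` (= C1′ `dim HT²` of an abelian `n`-fold, = C13's `q = 0` block). -/
theorem choose_two_add_eq (n : ℕ) : (n + n).choose 2 = 2 * n ^ 2 - n := by
  have h1 : n ≤ 2 * n ^ 2 := by nlinarith
  have key : (((n + n).choose 2 : ℕ) : ℚ) = ((2 * n ^ 2 - n : ℕ) : ℚ) := by
    push_cast [Nat.cast_sub h1]
    rw [Nat.cast_choose_two]
    push_cast
    ring
  exact_mod_cast key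

/-- the signed if-chain `sigmaBlockRank` of file 1/3, rewritten over binomials (`n ≥ 1`). -/
theorem sigmaBlockRank_eq_choose (n q : ℕ) :
    sigmaBlockRank n q =
      if q = 0 ∨ q = n + n - 2 then 2 * n.choose 2 + n * n
      else if q = n - 1 then 2 * (n * n)
      else if q = n - 2 ∨ q = n then 2 * n.choose 2
      else 0 := by
  rw [sigmaBlockRank, ← choose_two_add, choose_two_add_eq, two_mul_choose_two, sq]

/-- **C13 = `[t² u^q] Q_n²`, uniformly**: for every `n ≥ 3` and every `q`, `blockCount n 2 q = sigmaBlockRank n q` — STRUCTURE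
§1.1 C13's closed form `(2n² − n, n² − n, 2n², n² − n, 2n² − n)` at `q = (0, n−2, n−1, n, 2n−2)`, `0` elsewhere, IS th-6's
generating function (the five `q`-values are pairwise distinct exactly when `n ≥ 3`). -/
theorem blockCount_two_eq_sigmaBlockRank {n : ℕ} (hn : 3 ≤ n) (q : ℕ) : blockCount n 2 q = sigmaBlockRank n q := by
  rw [sigmaBlockRank_eq_choose, blockCount, Finset.Nat.sum_antidiagonal_succ, Finset.Nat.sum_antidiagonal_succ,
    Finset.Nat.antidiagonal_zero, Finset.sum_singleton]
  simp only [sum_antidiagonal_qAtom, Nat.choose_zero_right, Nat.choose_one_right, zero_add]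
  have h0 : (0 : ℕ) < n := by omega
  have h1 : (1 : ℕ) < n := by omega
  have h2 : (2 : ℕ) < n := by omega
  simp only [h0, h1, h2, true_and, Nat.sub_zero, one_mul, mul_one]
  generalize n.choose 2 = c
  split_ifs <;> omega

/-- … and as a polynomial coefficient: `[t² u^q] Q_n(t,u)² = sigmaBlockRank n q` (`n ≥ 3`). -/
theorem coeff_Q_sq_two {n : ℕ} (hn : 3 ≤ n) (q : ℕ) : ((Q n ^ 2).coeff 2).coeff q = (sigmaBlockRank n q : ℤ) := by
  rw [coeff_Q_sq, blockCount_two_eq_sigmaBlockRank hn]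

/-- the rows `n = 1, 2` (where C13's five `q`-values collide): `[t² u^q]Q_n²` is `(1, 0, …)` at `n = 1` and `(6, 8, 6, 0, …)` at
`n = 2` — equal to the if-chain `sigmaBlockRank` there as well (STEP-0's signed `(6, 8, 6)`; the top collapse `i = n = 2` is
what turns the naive `(8, 8, 8)` into `(6, 8, 6)`). -/
theorem blockCount_two_small :
    (List.range 4).map (blockCount 1 2) = (List.range 4).map (sigmaBlockRank 1) ∧
    (List.range 6).map (blockCount 2 2) = (List.range 6).map (sigmaBlockRank 2) ∧
    (List.range 6).map (blockCount 2 2) = [6, 8, 6, 0, 0, 0] := by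
  decide

/-- **SERRE-TYPE PALINDROME**: `[t^k u^q] Q_n² = [t^k u^{2n−k−q}] Q_n²` for `k ≤ 2n`, `q ≤ 2n − k` — the per-`q` vectors are
palindromic (th-6's atom: global `@ 0` ↔ local `@ n − i`; in the wedge model, the swap `X ↔ Y`, `X′ ↔ Y′`), so the choice of which
block of a factor is called «local» does not change the numbers. -/
theorem blockCount_symm {n k q : ℕ} (hk : k ≤ n + n) (hq : q ≤ n + n - k) :
    blockCount n k (n + n - k - q) = blockCount n k q := by
  unfold blockCount
  refine Finset.sum_congr rfl fun ij hij => ?_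
  rw [Finset.HasAntidiagonal.mem_antidiagonal] at hij
  rw [sum_antidiagonal_qAtom, sum_antidiagonal_qAtom]
  rcases Nat.lt_or_ge n ij.1 with hi | hi
  · simp [Nat.choose_eq_zero_of_lt hi]
  rcases Nat.lt_or_ge n ij.2 with hj | hj
  · simp [Nat.choose_eq_zero_of_lt hj]
  generalize n.choose ij.1 * n.choose ij.2 = C
  split_ifs <;> omega

/-! ## §4. The overlap count: `Σ_q [t^m u^q] Q_n² = R_m(n) + 2 r_m(n) + [m = 0]` -/

/-- `(Q_n²)(t,1) = (1 + P_n(t))²`. -/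
theorem map_evalOne_Q_sq (n : ℕ) : (Q n ^ 2).map (evalRingHom 1) = (1 + P n) ^ 2 := by
  rw [Polynomial.map_pow, map_evalOne_Q]

/-- coefficient form: `[t^m] (Q_n²)(t,1) = R_m(n) + 2·r_m(n) + [m = 0]` (`boxRank`, `transversePairRank` of files 1/3 and th-6). -/
theorem coeff_map_evalOne_Q_sq (n m : ℕ) :
    ((Q n ^ 2).map (evalRingHom 1)).coeff m =
      (boxRank n m : ℤ) + 2 * (transversePairRank n m : ℤ) + if m = 0 then 1 else 0 := by
  rw [map_evalOne_Q_sq, show (1 + P n) ^ 2 = P n ^ 2 + 2 * P n + 1 by ring, coeff_add, coeff_add, coeff_P_sq,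
    coeff_one, mul_comm, coeff_mul_ofNat, coeff_P, mul_comm]

/-- **OVERLAP COUNT** (red-5's reader caution, STRUCTURE C13 v0.27, in closed form): summing the per-`q` block counts over `q`
gives the box rank `R_m(n)` PLUS `2 r_m(n)` (plus `1` in degree `0`) — the blocks are not additive; e.g. `60 = 48 + 12` at
`n = 3`, `m = 2` and `224 = 208 + 16` at `n = 4`, `m = 3`.  (The sum runs over all `q` up to the `u`-degree of `[t^m]Q_n²`, i.e.
over every `q` with a non-zero block.) -/
theorem sum_blockCount (n m : ℕ) :
    (∑ q ∈ range (((Q n ^ 2).coeff m).natDegree + 1), (blockCount n m q : ℤ)) =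
      (boxRank n m : ℤ) + 2 * (transversePairRank n m : ℤ) + if m = 0 then 1 else 0 := by
  rw [← coeff_map_evalOne_Q_sq, coeff_map, coe_evalRingHom, eval_eq_sum_range]
  simp only [one_pow, mul_one, coeff_Q_sq]

/-- the two quoted instances of the overlap count: `Σ_q = 60 = 48 + 12` (`n = 3`, `m = 2`) and `224 = 208 + 16` (`n = 4`, `m = 3`). -/
theorem sum_blockCount_instances :
    (∑ q ∈ range 5, blockCount 3 2 q, boxRank 3 2, transversePairRank 3 2) = (60, 48, 6) ∧
    (∑ q ∈ range 6, blockCount 4 3 q, boxRank 4 3, transversePairRank 4 3) = (224, 208, 8) := by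
  decide

/-! ## §5. The measured per-`q` vectors of record (FORMULA-N §4.1″ «17/17 exact»; «MIDDLE DEGREES 21/21») -/

/-- degree 1, closed form for `n ≥ 2`: `2n` at `q ∈ {0, n−1, n, 2n−1}`, `0` elsewhere («degree 1: (2n @ 0, 2n @ n−1, 2n @ n,
2n @ 2n−1)»). -/
theorem blockCount_one {n : ℕ} (hn : 2 ≤ n) (q : ℕ) :
    blockCount n 1 q = if q = 0 ∨ q = n - 1 ∨ q = n ∨ q = n + n - 1 then 2 * n else 0 := by
  rw [blockCount, Finset.Nat.sum_antidiagonal_succ, Finset.Nat.antidiagonal_zero, Finset.sum_singleton]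
  simp only [sum_antidiagonal_qAtom, Nat.choose_zero_right, Nat.choose_one_right, zero_add]
  have h0 : (0 : ℕ) < n := by omega
  have h1 : (1 : ℕ) < n := by omega
  simp only [h0, h1, true_and, Nat.sub_zero, one_mul, mul_one]
  split_ifs <;> omega

/-- `C(2n,3) = 2·C(n,3) + 2n·C(n,2)` (Vandermonde in degree 3). -/
theorem choose_three_add (n : ℕ) : (n + n).choose 3 = 2 * n.choose 3 + 2 * (n * n.choose 2) := by
  rw [Nat.add_choose_eq, Finset.Nat.sum_antidiagonal_succ, Finset.Nat.sum_antidiagonal_succ,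
    Finset.Nat.sum_antidiagonal_succ, Finset.Nat.antidiagonal_zero, Finset.sum_singleton]
  simp
  ring

/-- `2n·C(n,2) = n²(n−1)`: the degree-3 middle blocks in th-6's spelling. -/
theorem two_mul_mul_choose_two (n : ℕ) : 2 * (n * n.choose 2) = n ^ 2 * (n - 1) := by
  have key : ((2 * (n * n.choose 2) : ℕ) : ℚ) = ((n ^ 2 * (n - 1) : ℕ) : ℚ) := by
    rcases Nat.eq_zero_or_pos n with rfl | hn
    · simp
    · push_cast [Nat.cast_sub hn]
      rw [Nat.cast_choose_two]
      ring
  exact_mod_cast key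

/-- **degree 3, closed form for every `n ≥ 4`** (FORMULA-N §4.1″ «degree 3 (n ≥ 4): (C(2n,3) @ 0, 2C(n,3) @ n−3, n²(n−1) @ n−2,
n²(n−1) @ n−1, 2C(n,3) @ n, C(2n,3) @ 2n−3)»; `n²(n−1) = 2n·C(n,2)` by `two_mul_mul_choose_two`): the six `q`-values are pairwise
distinct exactly when `n ≥ 4` (at `n = 3`, `q = 0` and `q = n − 3` coincide: `(20, 18, 18, 20)`, `blockCount_rows_three_four`). -/
theorem blockCount_three {n : ℕ} (hn : 4 ≤ n) (q : ℕ) :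
    blockCount n 3 q =
      if q = 0 ∨ q = n + n - 3 then (n + n).choose 3
      else if q = n - 3 ∨ q = n then 2 * n.choose 3
      else if q = n - 2 ∨ q = n - 1 then 2 * (n * n.choose 2)
      else 0 := by
  rw [choose_three_add, blockCount, Finset.Nat.sum_antidiagonal_succ, Finset.Nat.sum_antidiagonal_succ,
    Finset.Nat.sum_antidiagonal_succ, Finset.Nat.antidiagonal_zero, Finset.sum_singleton]
  simp only [sum_antidiagonal_qAtom, Nat.choose_zero_right, Nat.choose_one_right, zero_add]
  have h0 : (0 : ℕ) < n := by omega
  have h1 : (1 : ℕ) < n := by omega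
  have h2 : (2 : ℕ) < n := by omega
  have h3 : (3 : ℕ) < n := by omega
  simp only [h0, h1, h2, h3, true_and, Nat.sub_zero, one_mul, mul_one]
  generalize n.choose 2 = c
  generalize n.choose 3 = d
  -- one case per special value of `q`, the `if`s discharged by `omega`
  by_cases hq0 : q = 0
  · simp (disch := omega) only [if_pos, if_neg]; ring
  by_cases hq1 : q = n - 3
  · simp (disch := omega) only [if_pos, if_neg]; ring
  by_cases hq2 : q = n - 2
  · simp (disch := omega) only [if_pos, if_neg]; ring
  by_cases hq3 : q = n - 1
  · simp (disch := omega) only [if_pos, if_neg]; ring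
  by_cases hq4 : q = n
  · simp (disch := omega) only [if_pos, if_neg]; ring
  by_cases hq5 : q = n + n - 3
  · simp (disch := omega) only [if_pos, if_neg]; ring
  simp (disch := omega) only [if_neg, add_zero]

/-- degree 1 and 2 rows of record: `(4,4,4,4)`, `(6,0,6,6,0,6)`, `(8,0,0,8,8,0,0,8)`, `(10,0,0,0,10,10,0,0,0,10)` (degree 1,
`n = 2..5`) and `(6,8,6)`, `(15,6,18,6,15)`, `(28,0,12,32,12,0,28)`, `(45,0,0,20,50,20,0,0,45)` (degree 2, `n = 2..5`; the signed
STRUCTURE C13 cells, `= sigmaBlockRank` of file 1/3). -/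
theorem blockCount_rows_one_two :
    (List.range 4).map (blockCount 2 1) = [4, 4, 4, 4] ∧
    (List.range 6).map (blockCount 3 1) = [6, 0, 6, 6, 0, 6] ∧
    (List.range 8).map (blockCount 4 1) = [8, 0, 0, 8, 8, 0, 0, 8] ∧
    (List.range 10).map (blockCount 5 1) = [10, 0, 0, 0, 10, 10, 0, 0, 0, 10] ∧
    (List.range 3).map (blockCount 2 2) = [6, 8, 6] ∧
    (List.range 5).map (blockCount 3 2) = [15, 6, 18, 6, 15] ∧
    (List.range 7).map (blockCount 4 2) = [28, 0, 12, 32, 12, 0, 28] ∧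
    (List.range 9).map (blockCount 5 2) = [45, 0, 0, 20, 50, 20, 0, 0, 45] := by
  decide

/-- degree 3 and the middle degree: `(20,18,18,20)` (`n = 3`: `q = 0` and `q = n − 3` coincide), `(56,8,48,48,8,56)` (`n = 4`),
`(120,0,20,100,100,20,0,120)` (`n = 5`) and `(70,32,72,32,70)` (`n = m = 4`, «MIDDLE DEGREES»; `Σ = 276 = 274 + 2 = R₄(4) + 2r₄(4)`). -/
theorem blockCount_rows_three_four :
    (List.range 4).map (blockCount 3 3) = [20, 18, 18, 20] ∧
    (List.range 6).map (blockCount 4 3) = [56, 8, 48, 48, 8, 56] ∧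
    (List.range 8).map (blockCount 5 3) = [120, 0, 20, 100, 100, 20, 0, 120] ∧
    (List.range 5).map (blockCount 4 4) = [70, 32, 72, 32, 70] := by
  decide

/-- the `n = 6, 7, 8` rows of record (FORMULA-N §4.1″, measured by t26sig at ref-4, REF4-STRUCTURE-XCHECK v0.1): degree 2
`(66,0,0,0,30,72,30,0,0,0,66)`, `(91,0,0,0,0,42,98,42,0,0,0,0,91)`, `(120,0,0,0,0,0,56,128,56,0,0,0,0,0,120)` and degree 3
`(220,0,0,40,180,180,40,0,0,220)`, `(364,0,0,0,70,294,294,70,0,0,0,364)`, `(560,0,0,0,0,112,448,448,112,0,0,0,0,560)` — with these,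
all 17 per-`q` vectors of §4.1″'s check list (degrees 1–3, `n = 2..8`) are replayed by `decide`. -/
theorem blockCount_rows_six_to_eight :
    (List.range 11).map (blockCount 6 2) = [66, 0, 0, 0, 30, 72, 30, 0, 0, 0, 66] ∧
    (List.range 10).map (blockCount 6 3) = [220, 0, 0, 40, 180, 180, 40, 0, 0, 220] ∧
    (List.range 13).map (blockCount 7 2) = [91, 0, 0, 0, 0, 42, 98, 42, 0, 0, 0, 0, 91] ∧
    (List.range 12).map (blockCount 7 3) = [364, 0, 0, 0, 70, 294, 294, 70, 0, 0, 0, 364] ∧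
    (List.range 15).map (blockCount 8 2) = [120, 0, 0, 0, 0, 0, 56, 128, 56, 0, 0, 0, 0, 0, 120] ∧
    (List.range 14).map (blockCount 8 3) = [560, 0, 0, 0, 0, 112, 448, 448, 112, 0, 0, 0, 0, 560] := by
  decide

end Summit.Ventures.HSemireg.FormulaN.Uniform
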